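import Summits.AtomisticToContinuum.Crystallization.Theorems.ChartedPlanarOrderPairModulusTail
import Summits.AtomisticToContinuum.Crystallization.Theorems.ChartedPlanarOrderLatticeSmear

/-!
# Interlayer HEIGHT FLOOR and cell windows of a UNIFORMLY CLEAN stacked configuration (decomp-a2c lens-3 g25, task «TAIL CONSTANT» (1))

The tail constant of the channel split (`…PairModulusTail`, slot `K` of `PowerPairModulusRef` / budget `B₂` of `PairModulusTailRef`) scales
like `θ⁻⁶` in the height floor `θ = h − ρ` of the layer increments; the floor of record (`…StackedUniform.stackedUniform`:
`192/425·‖a‖ ≈ 0.38`) is what makes the as-typed constant `tailConst (1/40) ≈ 4·10¹⁰` useless.  This file proves the SHARP floor available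
in the reference currency (binder `UniformlyClean (Layered a b w)` of `TubeConvexRef`): at the clean spacing `a' ∈ [47/50, 1]`

* §1 the CIRCUMRADIUS COVERING LEMMA of a planar lattice `ℤa + ℤb` (pure algebra): every planar vector is within
  `R² = ‖a‖²‖b‖²·min(‖a−b‖²,‖a+b‖²) / (4G)` (squared circumradius of the fundamental triangle, `G` the Gram determinant) of a lattice vector —
  by the barycentric identity `(1−s−t)‖y‖² + s‖y−a‖² + t‖y−b‖² = R² − ‖y − O‖² ≤ R²` (`y = s a + t b`), proved as a sum of squares;
* §2 the metric consequences of the relaxed gapped-twelve test `RT a' s` at every margin `s > 0`: distinct sites are `≥ 49a'/50` apart and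
  either `≤ 51a'/50` or `≥ 63a'/50` apart; hence the CELL WINDOWS `‖a‖, ‖b‖ ∈ [49a'/50, 51a'/50]`, `‖a ± b‖ ≥ 49a'/50`, the T/S dichotomy
  `min(‖a−b‖,‖a+b‖) ≤ 51a'/50` (near-triangular cell) or `≥ 63a'/50` (near-square cell), and the bounds on `|⟪a,b⟫|` and on `G` from below;
* §3 ★ THE HEIGHT FLOOR: the layer-`(m+1)` atom nearest to `w m` is `≥ 49a'/50` away and has planar offset `≤ R`, so
  `H² ≥ (49a'/50)² − R²`: UNIVERSALLY `H ≥ 33a'/50` (`R² ≤ (‖a‖²+‖b‖²)/4`), and `H ≥ 39a'/50` over a near-triangular cell (`R² ≤ (51a'/50)²/3`);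
  in absolute terms `H ≥ 0.62` / `0.733` against the `0.38` of record (ideal: `a'·√(1/2) ≈ 0.686`, `a'·√(2/3) ≈ 0.79`);
* §4 the packaged configuration-level statement `cleanStackedWindows` under the binder list of `TubeConvexRef` (unit normal from `IsStacked`).

Consumers: the sharpened tail constant (`…PairModulusSharp`, this generation) and lens-4's registry-geometry leaves (R3geo / SqR3geo need the
interlayer heights).  All proofs sorry-free, standard axioms; no instances, no notation.
-/

noncomputable section

namespace Summit.AtomisticToContinuum.Crystallization.Theorems.ChartedPlanarOrderHeightFloor

open Set Metric
open scoped RealInnerProductSpace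
open Summit.AtomisticToContinuum.Crystallization.Theorems.ChartedPlanarOrderRigidityDoor (E3)
open Summit.AtomisticToContinuum.Crystallization.Theorems.ChartedPlanarOrderDoorLayered (Layered)
open Summit.AtomisticToContinuum.Crystallization.Theorems.ChartedPlanarOrderLayerFrame (norm_sq_eq_planar_add_height
  norm_sq_add_smul_normal exists_planar_coords)
open Summit.AtomisticToContinuum.Crystallization.Theorems.ChartedPlanarOrderStackedLayerGeometry (sub_period_mem add_period_mem offset_mem
  inner_period_combo)
open Summit.AtomisticToContinuum.Crystallization.Theorems.ChartedPlanarOrderProfileSlavingLJ (IsStacked incr)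
open Summit.AtomisticToContinuum.Crystallization.Theorems.OverbindingBudgetPeriodicCleanOrStrained (UniformlyClean)
open Summit.AtomisticToContinuum.Crystallization.Theorems.OverbindingBudgetViolatorDensityFloor (RT)
open Summit.AtomisticToContinuum.Crystallization.Theorems.ChartedPlanarOrderPairModulus (gram_pos)
open Summit.AtomisticToContinuum.Crystallization.Theorems.ChartedPlanarOrderSepCounting (exists_unit_normal)
-- landing note (hand-2 g12): `norm_sq_lin` is taken from the landed sibling `…LatticeSmear` (gate dedup.landed); its copy here was deleted.
open Summit.AtomisticToContinuum.Crystallization.Theorems.ChartedPlanarOrderLatticeSmear (norm_sq_lin)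

/-! ## §1 The circumradius covering lemma of a planar lattice -/


/-- the BARYCENTRIC IDENTITY: with the barycentric weights `(1−s−t, s, t)` of `y = s a + t b` in the triangle `(0, a, b)`,
`(1−s−t)‖y‖² + s‖y−a‖² + t‖y−b‖² = ‖a‖² s(1−s) + ‖b‖² t(1−t) − 2⟪a,b⟫ s t`. [folklore] -/
theorem bary_sum (a b : E3) (s t : ℝ) :
    (1 - s - t) * ‖s • a + t • b‖ ^ 2 + s * ‖s • a + t • b - a‖ ^ 2 + t * ‖s • a + t • b - b‖ ^ 2 =
      ‖a‖ ^ 2 * (s * (1 - s)) + ‖b‖ ^ 2 * (t * (1 - t)) - 2 * ⟪a, b⟫ * (s * t) := by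
  have e1 : s • a + t • b - a = (s - 1) • a + t • b := by rw [sub_smul, one_smul]; abel
  have e2 : s • a + t • b - b = s • a + (t - 1) • b := by rw [sub_smul, one_smul]; abel
  rw [e1, e2, norm_sq_lin, norm_sq_lin, norm_sq_lin]
  ring

/-- the barycentric sum is at most the squared circumradius `x y (x + y − 2p) / (4 (x y − p²))` (`x = ‖a‖²`, `y = ‖b‖²`, `p = ⟪a,b⟫`):
the difference is the squared distance to the circumcentre, a sum of squares. [folklore] -/
theorem quad_le_circumradius_sq {x y p : ℝ} (hx : 0 < x) (hG : 0 < x * y - p ^ 2) (s t : ℝ) :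
    x * (s * (1 - s)) + y * (t * (1 - t)) - 2 * p * (s * t) ≤ x * y * (x + y - 2 * p) / (4 * (x * y - p ^ 2)) := by
  rw [le_div_iff₀ (by positivity)]
  have key : x * (x * y - p ^ 2) * (x * y * (x + y - 2 * p) -
      (x * (s * (1 - s)) + y * (t * (1 - t)) - 2 * p * (s * t)) * (4 * (x * y - p ^ 2))) =
      (x * (2 * (x * y - p ^ 2) * s - y * (x - p)) + p * (2 * (x * y - p ^ 2) * t - x * (y - p))) ^ 2 +
        (x * y - p ^ 2) * (2 * (x * y - p ^ 2) * t - x * (y - p)) ^ 2 := by ring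
  have h3 : 0 ≤ x * (x * y - p ^ 2) * (x * y * (x + y - 2 * p) -
      (x * (s * (1 - s)) + y * (t * (1 - t)) - 2 * p * (s * t)) * (4 * (x * y - p ^ 2))) := by
    rw [key]; exact add_nonneg (sq_nonneg _) (mul_nonneg hG.le (sq_nonneg _))
  have h4 := (mul_nonneg_iff_of_pos_left (mul_pos hx hG)).1 h3
  linarith

/-- a point of the triangle `(0, a, b)` is within the circumradius of one of its vertices. [folklore] -/
theorem exists_vertex_near (a b : E3) (ha : a ≠ 0) (hG : 0 < ‖a‖ ^ 2 * ‖b‖ ^ 2 - ⟪a, b⟫ ^ 2) {s t : ℝ} (hs : 0 ≤ s) (ht : 0 ≤ t)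
    (hst : s + t ≤ 1) :
    min (min (‖s • a + t • b‖ ^ 2) (‖s • a + t • b - a‖ ^ 2)) (‖s • a + t • b - b‖ ^ 2) ≤
      ‖a‖ ^ 2 * ‖b‖ ^ 2 * ‖a - b‖ ^ 2 / (4 * (‖a‖ ^ 2 * ‖b‖ ^ 2 - ⟪a, b⟫ ^ 2)) := by
  have hx : 0 < ‖a‖ ^ 2 := by positivity
  have hE := quad_le_circumradius_sq hx hG s t
  have hsum := bary_sum a b s t
  rw [show ‖a - b‖ ^ 2 = ‖a‖ ^ 2 + ‖b‖ ^ 2 - 2 * ⟪a, b⟫ by rw [norm_sub_sq_real]; ring]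
  set f0 := ‖s • a + t • b‖ ^ 2
  set fa := ‖s • a + t • b - a‖ ^ 2
  set fb := ‖s • a + t • b - b‖ ^ 2
  have hm0 : min (min f0 fa) fb ≤ f0 := (min_le_left _ _).trans (min_le_left _ _)
  have hma : min (min f0 fa) fb ≤ fa := (min_le_left _ _).trans (min_le_right _ _)
  have hmb : min (min f0 fa) fb ≤ fb := min_le_right _ _
  nlinarith [mul_nonneg (by linarith : (0 : ℝ) ≤ 1 - s - t) (sub_nonneg.2 hm0), mul_nonneg hs (sub_nonneg.2 hma),
    mul_nonneg ht (sub_nonneg.2 hmb)]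

/-- point reflection of the cell: `s a + t b − b = −((1−s) a + (1−t) b − a)`. [folklore] -/
theorem reflect_sub_snd (a b : E3) (s t : ℝ) : s • a + t • b - b = -((1 - s) • a + (1 - t) • b - a) := by
  rw [sub_smul, sub_smul, one_smul, one_smul]; abel

/-- point reflection of the cell: `s a + t b − a = −((1−s) a + (1−t) b − b)`. [folklore] -/
theorem reflect_sub_fst (a b : E3) (s t : ℝ) : s • a + t • b - a = -((1 - s) • a + (1 - t) • b - b) := by
  rw [sub_smul, sub_smul, one_smul, one_smul]; abel

/-- ★ CIRCUMRADIUS COVERING (one diagonal): every planar vector `α a + β b` is within `R`, `R² = ‖a‖²‖b‖²‖a−b‖²/(4G)`, of a lattice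
vector `i a + j b`. [folklore] -/
theorem exists_lattice_near (a b : E3) (ha : a ≠ 0) (hG : 0 < ‖a‖ ^ 2 * ‖b‖ ^ 2 - ⟪a, b⟫ ^ 2) (α β : ℝ) :
    ∃ i j : ℤ, ‖(α • a + β • b) - ((i : ℝ) • a + (j : ℝ) • b)‖ ^ 2 ≤
      ‖a‖ ^ 2 * ‖b‖ ^ 2 * ‖a - b‖ ^ 2 / (4 * (‖a‖ ^ 2 * ‖b‖ ^ 2 - ⟪a, b⟫ ^ 2)) := by
  set R2 := ‖a‖ ^ 2 * ‖b‖ ^ 2 * ‖a - b‖ ^ 2 / (4 * (‖a‖ ^ 2 * ‖b‖ ^ 2 - ⟪a, b⟫ ^ 2))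
  set s := α - ⌊α⌋ with hs_def
  set t := β - ⌊β⌋ with ht_def
  have hs0 : 0 ≤ s := by have := Int.floor_le α; linarith
  have hs1 : s < 1 := by have := Int.lt_floor_add_one α; linarith
  have ht0 : 0 ≤ t := by have := Int.floor_le β; linarith
  have ht1 : t < 1 := by have := Int.lt_floor_add_one β; linarith
  have e00 : (α • a + β • b) - (((⌊α⌋ : ℤ) : ℝ) • a + ((⌊β⌋ : ℤ) : ℝ) • b) = s • a + t • b := by
    rw [hs_def, ht_def, sub_smul, sub_smul]; abel
  have e10 : (α • a + β • b) - (((⌊α⌋ + 1 : ℤ) : ℝ) • a + ((⌊β⌋ : ℤ) : ℝ) • b) = s • a + t • b - a := by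
    rw [hs_def, ht_def, sub_smul, sub_smul]; push_cast; rw [add_smul, one_smul]; abel
  have e01 : (α • a + β • b) - (((⌊α⌋ : ℤ) : ℝ) • a + ((⌊β⌋ + 1 : ℤ) : ℝ) • b) = s • a + t • b - b := by
    rw [hs_def, ht_def, sub_smul, sub_smul]; push_cast; rw [add_smul, one_smul]; abel
  have e11 : (α • a + β • b) - (((⌊α⌋ + 1 : ℤ) : ℝ) • a + ((⌊β⌋ + 1 : ℤ) : ℝ) • b) = -((1 - s) • a + (1 - t) • b) := by
    rw [hs_def, ht_def, sub_smul, sub_smul, sub_smul, sub_smul, one_smul, one_smul]; push_cast; rw [add_smul, add_smul, one_smul, one_smul]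
    abel
  rcases le_or_gt (s + t) 1 with hst | hst
  · have hmin := exists_vertex_near a b ha hG hs0 ht0 hst
    simp only [min_le_iff] at hmin
    rcases hmin with (h | h) | h
    · exact ⟨⌊α⌋, ⌊β⌋, by rwa [e00]⟩
    · exact ⟨⌊α⌋ + 1, ⌊β⌋, by rwa [e10]⟩
    · exact ⟨⌊α⌋, ⌊β⌋ + 1, by rwa [e01]⟩
  · have hst' : (1 - s) + (1 - t) ≤ 1 := by linarith
    have hmin := exists_vertex_near a b ha hG (by linarith : (0 : ℝ) ≤ 1 - s) (by linarith : (0 : ℝ) ≤ 1 - t) hst'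
    simp only [min_le_iff] at hmin
    rcases hmin with (h | h) | h
    · exact ⟨⌊α⌋ + 1, ⌊β⌋ + 1, by rwa [e11, norm_neg]⟩
    · refine ⟨⌊α⌋, ⌊β⌋ + 1, ?_⟩
      rw [e01, reflect_sub_snd, norm_neg]
      exact h
    · refine ⟨⌊α⌋ + 1, ⌊β⌋, ?_⟩
      rw [e10, reflect_sub_fst, norm_neg]
      exact h

/-- ★ CIRCUMRADIUS COVERING (the shorter diagonal): `R² = ‖a‖²‖b‖²·min(‖a−b‖²,‖a+b‖²)/(4G)`. [folklore] -/
theorem exists_lattice_near_min (a b : E3) (ha : a ≠ 0) (hG : 0 < ‖a‖ ^ 2 * ‖b‖ ^ 2 - ⟪a, b⟫ ^ 2) (α β : ℝ) :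
    ∃ i j : ℤ, ‖(α • a + β • b) - ((i : ℝ) • a + (j : ℝ) • b)‖ ^ 2 ≤
      ‖a‖ ^ 2 * ‖b‖ ^ 2 * min (‖a - b‖ ^ 2) (‖a + b‖ ^ 2) / (4 * (‖a‖ ^ 2 * ‖b‖ ^ 2 - ⟪a, b⟫ ^ 2)) := by
  rcases le_total (‖a - b‖ ^ 2) (‖a + b‖ ^ 2) with h | h
  · rw [min_eq_left h]; exact exists_lattice_near a b ha hG α β
  · rw [min_eq_right h]
    have hG' : 0 < ‖a‖ ^ 2 * ‖-b‖ ^ 2 - ⟪a, -b⟫ ^ 2 := by rwa [norm_neg, inner_neg_right, neg_sq]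
    obtain ⟨i, j, hij⟩ := exists_lattice_near a (-b) ha hG' α (-β)
    refine ⟨i, -j, ?_⟩
    rw [norm_neg, inner_neg_right, neg_sq, sub_neg_eq_add] at hij
    have e : α • a + β • b - ((i : ℝ) • a + (((-j : ℤ) : ℝ)) • b) = α • a + -β • -b - ((i : ℝ) • a + (j : ℝ) • -b) := by
      push_cast; rw [smul_neg, smul_neg, neg_smul, neg_smul, neg_neg]
    rw [e]; exact hij

/-! ## §2 Metric consequences of the relaxed gapped-twelve test at every margin -/

section Clean

variable {Y : Set E3} {a' : ℝ}

/-- distinct sites of an `RT a' s`-clean (all `s > 0`) set are `≥ 49a'/50` apart. -/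
theorem dist_ge_of_RT (h : ∀ y ∈ Y, ∀ s : ℝ, 0 < s → RT a' s Y y) {u v : E3} (hu : u ∈ Y) (hv : v ∈ Y) (huv : u ≠ v) :
    a' * (49 / 50) ≤ dist u v := by
  by_contra hlt
  push Not at hlt
  obtain ⟨-, -, hfar⟩ := h u hu ((a' * (49 / 50) - dist u v) / 2) (by linarith)
  have h1 := (hfar v hv huv.symm).1
  linarith

/-- … and either `≤ 51a'/50` or `≥ 63a'/50` apart (the gap of the test). -/
theorem dist_dichotomy_of_RT (h : ∀ y ∈ Y, ∀ s : ℝ, 0 < s → RT a' s Y y) {u v : E3} (hu : u ∈ Y) (hv : v ∈ Y) (huv : u ≠ v) :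
    dist u v ≤ a' * (51 / 50) ∨ a' * (63 / 50) ≤ dist u v := by
  by_contra hc
  push Not at hc
  obtain ⟨h1, h2⟩ := hc
  have hs : 0 < min (dist u v - a' * (51 / 50)) (a' * (63 / 50) - dist u v) / 2 :=
    by have := lt_min (sub_pos.2 h1) (sub_pos.2 h2); linarith
  obtain ⟨-, -, hfar⟩ := h u hu _ hs
  have hm1 := min_le_left (dist u v - a' * (51 / 50)) (a' * (63 / 50) - dist u v)
  have hm2 := min_le_right (dist u v - a' * (51 / 50)) (a' * (63 / 50) - dist u v)
  rcases (hfar v hv huv.symm).2 with h3 | h3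
  · linarith
  · linarith

/-- the norm of a nonzero difference vector `x` of the set (`q, q + x ∈ Y`) lies in the clean windows. -/
theorem norm_window_of_RT (h : ∀ y ∈ Y, ∀ s : ℝ, 0 < s → RT a' s Y y) {q x : E3} (hq : q ∈ Y) (hqx : q + x ∈ Y) (hx : x ≠ 0) :
    a' * (49 / 50) ≤ ‖x‖ ∧ (‖x‖ ≤ a' * (51 / 50) ∨ a' * (63 / 50) ≤ ‖x‖) := by
  have hne : q + x ≠ q := by intro e; apply hx; simpa using e
  have hd : dist (q + x) q = ‖x‖ := by rw [dist_eq_norm, add_sub_cancel_left]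
  exact ⟨hd ▸ dist_ge_of_RT h hqx hq hne, hd ▸ dist_dichotomy_of_RT h hqx hq hne⟩

/-- a difference vector of norm `≤ 17/16` is a nearest-neighbour bond: `‖x‖ ≤ 51a'/50` (`a' ≥ 47/50`). -/
theorem norm_le_of_RT (h : ∀ y ∈ Y, ∀ s : ℝ, 0 < s → RT a' s Y y) (ha' : 47 / 50 ≤ a') {q x : E3} (hq : q ∈ Y) (hqx : q + x ∈ Y)
    (hx : x ≠ 0) (hxn : ‖x‖ ≤ 17 / 16) : a' * (49 / 50) ≤ ‖x‖ ∧ ‖x‖ ≤ a' * (51 / 50) := by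
  obtain ⟨hlo, hhi | hhi⟩ := norm_window_of_RT h hq hqx hx
  · exact ⟨hlo, hhi⟩
  · exfalso; linarith

end Clean

-- landing note (hand-2 g12): lens-3 g25 (a) HeightFloor 47b92903 (424 l) PRE-SPLIT for the gate's 400-line rule; the remaining sections continue,
-- byte-identical and in the same namespace, in `ChartedPlanarOrderHeightFloorB`.

end Summit.AtomisticToContinuum.Crystallization.Theorems.ChartedPlanarOrderHeightFloor
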